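import Summits.BirchSwinnertonDyer.BirchSwinnertonDyer.Theorems.ManinLocalTwoThreeCDivisionWitnessUDC
import Summits.BirchSwinnertonDyer.BirchSwinnertonDyer.Theorems.ManinLocalTwoThreeCDivisionWitnessCore
import Summits.BirchSwinnertonDyer.BirchSwinnertonDyer.Theorems.ManinLocalTwoThreeCDivisionGrowth
import Summits.BirchSwinnertonDyer.BirchSwinnertonDyer.Theorems.ManinLocalTwoThreeCDivisionCuspSeries
import Summits.BirchSwinnertonDyer.BirchSwinnertonDyer.Theorems.ManinLocalTwoThreeIntegralCuspPresentation
import HarnessLib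

/-!
# THE `c`-DIVISION WITNESS, ASSEMBLED (def-free): `exists_cDivisionWitness`, and
# **C3 `ManinPrimeToThreeAtNine` ⟸ CDT**, **C2 `ManinOddAtFour` ⟸ CDT ∧ E-an-152b**
(route `ManinLocalTwoThree`, cruxes C2 stmt-BirchSwinnertonDyer-22967 / C3 stmt-BirchSwinnertonDyer-22968; cell bsd-f2-manin, prover p3 gen 18;
design -an g44 (MEMO-an §89), nodes N1–N5 by p2 g20 (`…CDivisionPoleKill`, `…CDivisionWitnessCore`), N6/N7 by p3 g18 (`…CDivisionGrowth`, `…CDivisionCuspSeries`))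

`F = 12·℘_{Λ_W}(ℰ_f)·G·Δ^a`, the `x`-coordinate of the `c`-division point `H = u_W∘ℰ_f` (`[c]H = φ`) times an integer cusp form `G` presenting
`x' = ℘_{c⁻¹Λ_W}(ℰ_f)` and `Δ^a`.  Order of construction (as -an's `cDivisionWitnessLaw_of_nodes`): the cover group `Γ^{(c)}` (`exists_cDivisionCoverSubgroup`) ↝ the
exponent `a` from `Γ^{(c)}` ALONE (`CDivGrowth.cDivGrowth_uniform`) ↝ `(k, G, F)` with exact stabiliser `Γ^{(c)}` (p2's `exists_cDivisionWitnessCore D hc a`) ↝ growth ↝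
integer `q`-series near `i∞` (`CDivCuspGerm.cDivCuspSeries` + (QEXNB) `integralQSeriesNearCuspB_holds`) ↝ on `ℍ` ((QXP) `qExpansionExtensionPrinciple_holds`).
* `exists_cDivisionWitness D` — EXACTLY the body of -an's typed row `CDivisionWitnessLaw` for the datum `D` (so `cDivisionWitnessLaw_holds` is a one-liner once the row lands);
* `maninPrimeToThreeAtNine_of_CDT` — **C3 ⟸ the printed CDT fact ALONE** (`indexNine_of_cDivisionWitness_of_UDW` + `not_periodLatticeGamma1_eq_three_mul_periodLattice`);
* `maninOddAtFour_of_CDT_indexNeFour` — **C2 ⟸ CDT ∧ E-an-152b `ShimuraIndexNeFourAtFour`** (`indexFour_of_cDivisionWitness_of_UDW`).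
HONEST FRAMING.  CONDITIONAL results: CDT (Calegari–Dimitrov–Tang 2025, Thm. 1.0.1, all weights, algebraic-integer coefficients) is a PRINTED, statement-only
Literature fact, not proved in the tree; E-an-152b is OPEN.  C2/C3 as filed (with their printed-fact binders), Manin's conjecture and BSD are NOT proved here.
No definitions, no sorry. [cite: CalegariDimitrovTang2025, Thm. 1.0.1 and Remarks 58–59] [cite: KurthLong2008, Prop. 18] [cite: Honda1970, Thm. 9]
[cite: ShimuraIATAF1971, §2.4, Thm. 3.52, Thm. 7.14] [cite: Manin1972, Prop. 1.4, Thm. 1.6] [cite: Stevens1989, §2]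
-/

set_option autoImplicit false
-- lint-debt: the directory name repeats the summit name (sibling precedent `ManinLocalTwoThreeCDivisionWitnessCore.lean`)
set_option linter.dupNamespace false

noncomputable section

open scoped MatrixGroups ModularForm PeriodPair Manifold Topology
open CongruenceSubgroup Complex Filter PowerSeries
open UpperHalfPlane hiding I
open WeierstrassCurve Literature.NumberTheory.EllipticCurves Literature.NumberTheory.EllipticCurves.ModularForms
open Summit.BirchSwinnertonDyer.Rank1Residual.ManinAdditive
open Summit.BirchSwinnertonDyer.Rank1Residual.ManinAdditive.UDCKummerLineK
open Summit.BirchSwinnertonDyer.Rank1Residual.ManinAdditive.ShimuraKernel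

namespace Summit.BirchSwinnertonDyer.BirchSwinnertonDyer.Theorems.ManinLocalTwoThree.CDivAssembly

/-- An integer-coefficient cusp form is an integer `exp`-series on `ℍ`. [folklore] -/
theorem hasSum_int_of_cuspCoeff {N : ℕ} [NeZero N] {k : ℤ} (G : CuspForm (Gamma0 N) k) (bd : ℕ → ℤ)
    (hbd : ∀ m, cuspCoeff G m = bd m) (τ : ℍ) :
    HasSum (fun n : ℕ ↦ (bd n : ℂ) * Complex.exp (2 * Real.pi * Complex.I * (τ : ℂ) * n)) (G τ) :=
  ParamPoleJ.hasSum_int_qExpansion (G : ModularForm (Gamma0 N) k) bd (fun m ↦ hbd m) τ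

/-- **The `c`-division witness EXISTS for every datum** — exactly the body of -an g44's typed row `CDivisionWitnessLaw`: a weight `k` and a holomorphic
`F : ℍ → ℂ` with `Γ₀(N)`-stabiliser EXACTLY `Γ^{(c)} = {γ : {∞,γ∞}_f ∈ Λ_W}`, bounded at every cusp, with (algebraic-)INTEGER `q`-expansion on `ℍ`
(`F = 12·℘_{Λ_W}(ℰ_f)·G·Δ^a`; Honda at the multiplier `1`). [cite: Honda1970, Thm. 9] [cite: ShimuraIATAF1971, §2.4, Thm. 3.52, Thm. 7.14] [cite: Manin1972, Prop. 1.4] -/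
theorem exists_cDivisionWitness (W : WeierstrassCurve ℚ) [W.IsElliptic] [W.IsGloballyMinimal] {N : ℕ} [NeZero N]
    (D : ModularParametrizationData W N) :
    ∃ (k : ℤ) (F : ℍ → ℂ), MDifferentiable 𝓘(ℂ) 𝓘(ℂ) F ∧
      (∀ γ : Gamma0 N, cuspSymbol D.f γ ∈ D.L.lattice → F ∣[k] (γ : SL(2, ℤ)) = F) ∧
      (∀ γ : Gamma0 N, F ∣[k] (γ : SL(2, ℤ)) = F → cuspSymbol D.f γ ∈ D.L.lattice) ∧
      (∀ g : SL(2, ℤ), ∃ C A m : ℝ, ∀ τ : ℍ, A ≤ τ.im → ‖(F ∣[k] g) τ‖ ≤ C * Real.exp (m * τ.im)) ∧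
      (∃ b : ℕ → ℂ, (∀ n, IsIntegral ℤ (b n)) ∧ ∀ τ : ℍ,
        HasSum (fun n : ℕ ↦ b n * Complex.exp (2 * Real.pi * Complex.I * (τ : ℂ) * n)) (F τ)) := by
  classical
  have hf : D.f ≠ 0 := D.isNewformOf.1.ne_zero
  have hc : (D.c : ℂ) ≠ 0 := D.cast_c_ne_zero
  -- the cover group and the exponent
  obtain ⟨Γ, hmem, hle, hfi, -, -⟩ := CDivision.exists_cDivisionCoverSubgroup D
  obtain ⟨a, ha2, hgr⟩ := CDivGrowth.cDivGrowth_uniform W D Γ hle hfi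
  -- the core: presentation, extension, exact stabiliser
  obtain ⟨k, G, F, _hk, _hG0, hGint, hFhol, hFeq, hstab⟩ := CDivision.exists_cDivisionWitnessCore D hc a
  have hinv : ∀ γ : Gamma0 N, cuspSymbol D.f γ ∈ D.L.lattice → F ∣[k + 12 * (a : ℤ)] (γ : SL(2, ℤ)) = F :=
    fun γ h ↦ (hstab γ).mp h
  have hstab' : ∀ γ : Gamma0 N, F ∣[k + 12 * (a : ℤ)] (γ : SL(2, ℤ)) = F → cuspSymbol D.f γ ∈ D.L.lattice :=
    fun γ h ↦ (hstab γ).mpr h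
  -- growth
  have hFeq' : ∀ τ : ℍ, eichlerIntegral D.f τ ∉ D.L.lattice →
      F τ = ℘[D.L] (eichlerIntegral D.f τ) * ((12 : ℂ) * (G : ModularForm (Gamma0 N) k) τ * ModularForm.discriminant τ ^ a) := by
    intro τ hτ
    rw [← hFeq τ hτ]
    change _ = ℘[D.L] (eichlerIntegral D.f τ) * ((12 : ℂ) * G τ * ModularForm.discriminant τ ^ a)
    ring
  have hgrowth := hgr k (G : ModularForm (Gamma0 N) k) F (fun γ hγ ↦ hinv ⟨γ, hle hγ⟩ ((hmem ⟨γ, hle hγ⟩).mp hγ)) hFeq'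
  -- integer `q`-series near `i∞`, then on `ℍ`
  obtain ⟨g, B, hgden, hΦ⟩ := CDivCuspGerm.cDivCuspSeries W D a ha2
  choose bd hbd using hGint
  have hGsum : ∀ τ : ℍ, HasSum (fun n : ℕ ↦ (bd n : ℂ) * Complex.exp (2 * Real.pi * Complex.I * (τ : ℂ) * n)) (G τ) :=
    hasSum_int_of_cuspCoeff G bd hbd
  obtain ⟨T, hT⟩ := exists_forall_eichlerIntegral_smul_notMem D.f hf D.L 1
  obtain ⟨b, B', hbB'⟩ := IntegralQSeries.integralQSeriesNearCuspB_holds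
    (fun τ ↦ (12 : ℂ) * ℘[D.L] (eichlerIntegral D.f τ) * ModularForm.discriminant τ ^ a) F (fun τ ↦ G τ) g bd hgden ⟨B, hΦ⟩ hGsum
    ⟨T, fun τ hτ ↦ by rw [← hFeq τ (by simpa using hT τ hτ.le)]; ring⟩
  exact ⟨k + 12 * (a : ℤ), F, hFhol, hinv, hstab', hgrowth, fun n ↦ (b n : ℂ), fun n ↦ isIntegral_algebraMap (R := ℤ) (A := ℂ) (x := b n),
    IntegralQSeries.qExpansionExtensionPrinciple_holds F hFhol (fun n ↦ (b n : ℂ)) B' hbB'⟩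

/-- **C3 `ManinPrimeToThreeAtNine` ⟸ CDT ALONE.**  For every `X₀(N)`-OPTIMAL datum of a globally minimal `W` at a level `9 ∣ N`: `3 ∤ c`, modulo the printed
Unbounded-Denominators theorem of Calegari–Dimitrov–Tang (all weights, algebraic-integer coefficients).  The `c`-division witness (`exists_cDivisionWitness`) is
modular for a congruence subgroup by CDT, so `Γ(MN) ≤ Γ^{(c)} ≤ Γ^{(3)}` (`3 ∣ c`), which is LEAD's index-`9` configuration `Λ₁(f) = 3Λ₀(f)` — impossible
(`not_periodLatticeGamma1_eq_three_mul_periodLattice`).  CONDITIONAL on CDT; C3 as filed, Manin's conjecture and BSD are not proved by this.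
[cite: CalegariDimitrovTang2025, Thm. 1.0.1 and Remarks 58–59] [cite: KurthLong2008, Prop. 18] [cite: Stevens1989, §2] -/
theorem maninPrimeToThreeAtNine_of_CDT
    (hCDT : Literature.NumberTheory.Automorphic.CalegariDimitrovTang2025_unboundedDenominators_algInt) :
    Summit.BirchSwinnertonDyer.BirchSwinnertonDyer.Theses.ManinLocalTwoThree.ManinPrimeToThreeAtNine := by
  intro _hM _hAU _hC _hnf W _ _ N _ D hopt h9 h3c
  obtain ⟨k, F, hhol, hinv, hstab, hgrowth, hq⟩ := exists_cDivisionWitness W D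
  exact not_periodLatticeGamma1_eq_three_mul_periodLattice D hopt
    (CDivision.indexNine_of_cDivisionWitness_of_UDW D hopt h9 h3c (UDWOfCDT.unboundedDenominatorsWeightAlgInt_of_CDT_algInt hCDT k)
      hhol hinv hstab hgrowth hq)

/-- **C2 `ManinOddAtFour` ⟸ CDT ∧ E-an-152b `ShimuraIndexNeFourAtFour`.**  For every `X₀(N)`-optimal datum at `4 ∣ N`: `2 ∤ c`, modulo CDT and the index-`4`
exclusion (the `c`-division witness gives `Γ(MN) ≤ Γ^{(c)} ≤ Γ^{(2)}`, the index-`4` configuration).  CONDITIONAL on both; C2 as filed, Manin's conjecture and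
BSD are not proved by this. [cite: CalegariDimitrovTang2025, Thm. 1.0.1] [cite: KurthLong2008, Prop. 18] -/
theorem maninOddAtFour_of_CDT_indexNeFour
    (hCDT : Literature.NumberTheory.Automorphic.CalegariDimitrovTang2025_unboundedDenominators_algInt) (hI4 : ShimuraIndexNeFourAtFour) :
    Summit.BirchSwinnertonDyer.BirchSwinnertonDyer.Theses.ManinLocalTwoThree.ManinOddAtFour := by
  intro _hM _hAU _hC _hnf W _ _ N _ D hopt h4 h2c
  obtain ⟨k, F, hhol, hinv, hstab, hgrowth, hq⟩ := exists_cDivisionWitness W D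
  exact hI4 W D hopt h4 (CDivision.indexFour_of_cDivisionWitness_of_UDW D hopt h4 h2c
    (UDWOfCDT.unboundedDenominatorsWeightAlgInt_of_CDT_algInt hCDT k) hhol hinv hstab hgrowth hq)

end Summit.BirchSwinnertonDyer.BirchSwinnertonDyer.Theorems.ManinLocalTwoThree.CDivAssembly

end
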